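import Literature.NumberTheory.Sieve.LinearEquationsInPrimesProductNilmanifold
import Mathlib.Analysis.Complex.Basic

/-!
# Route `GreenTaoLevelTwo`, crux `GITwo` (stmt-Parity-21275), line `birth`, stub `stub_cyclicInverse`:
# tensor products of Lipschitz functions on product nilmanifolds (GT08a arXiv Lemma 65)

Sixtieth helper file toward the XL stub `stub_cyclicInverse` (B. Green, T. Tao, *An inverse
theorem for the Gowers `U³(G)` norm*, arXiv:math/0503014, Thm. 68 = PEMS 51 (2008) Thm. 12.8).
Block E16 (arXiv §12): "If `(G/Γ,T_g)` and `(G'/Γ',T_{g'})` are 2-step nilflows, then so is the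
direct sum … the function `F ⊗ F'(T_{(g,g')}ⁿ(x,x'))` factors as `F(T_gⁿ x) F'(T_{g'}ⁿ x')`" and
arXiv Lemma 65 ("the tensor product `F₁ ⊗ … ⊗ F_k` is `Kk`-Lipschitz").  In the tree the product
nilmanifold `X.prod Y` (`Literature…ProductNilmanifold`, max metric pulled back along
`quotientProdMap`) is the direct sum; this def-free file records, for COMPLEX-valued functions
(real and imaginary parts are taken only at the very end of the proof of Thm. 68):

* `prod_dist_eq` — the metric of `X.prod Y` is the max metric (definitional);
* `quotientProdMap_zpow_smul` — orbits in the product are pairs of orbits (`n ∈ ℤ`);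
* `norm_tensor_le_one`, `norm_tensor_sub_tensor_le` — `F ⊗ F'` is `1`-bounded and
  `(M + M')`-Lipschitz when `F, F'` are `1`-bounded and `M`-, `M'`-Lipschitz (arXiv Lemma 65);
* `isBoundedLipschitz_re`, `isBoundedLipschitz_im` — real and imaginary parts of a `1`-bounded
  `M`-Lipschitz complex function are `IsBoundedLipschitz M`;
* `half_le_abs_re_sum_or_im_sum` — a correlation `c ≤ ‖∑ aₙ Φₙ‖` with real `aₙ` gives
  `c/2 ≤ |∑ aₙ Re Φₙ|` or `c/2 ≤ |∑ aₙ Im Φₙ|`.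

References: [GreenTao2008U3Inverse] arXiv:math/0503014, §12, Lemma 65 and the paragraph before it.
-/

noncomputable section

namespace Summit.Parity.GeneralizedHardyLittlewood.GreenTaoLevelTwoGITwoCyclicInverse

open Literature.NumberTheory.Sieve

variable {s : ℕ} (X Y : Nilmanifold s)

/-- The metric of the product nilmanifold is the max of the metrics of the factors (definitional).
[cite: GreenTao2010, §8 (metrics on nilmanifolds are arbitrary)] -/
theorem prod_dist_eq (p q : (X.prod Y).G ⧸ (X.prod Y).Γ) :
    (X.prod Y).dist p q =
      max (X.dist (Nilmanifold.quotientProdMap X Y p).1 (Nilmanifold.quotientProdMap X Y q).1)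
        (Y.dist (Nilmanifold.quotientProdMap X Y p).2 (Nilmanifold.quotientProdMap X Y q).2) :=
  rfl

/-- **Orbits in a product are pairs of orbits**: `T_{(g,g')}ⁿ (x,x') = (T_gⁿ x, T_{g'}ⁿ x')`, `n ∈ ℤ`.
[cite: GreenTao2008U3Inverse, §12 (the paragraph before Lemma 65)] -/
theorem quotientProdMap_zpow_smul (gg : (X.prod Y).G) (p₀ : (X.prod Y).G ⧸ (X.prod Y).Γ)
    (n : ℤ) :
    Nilmanifold.quotientProdMap X Y (gg ^ n • p₀) =
      ((gg.1 : X.G) ^ n • (Nilmanifold.quotientProdMap X Y p₀).1,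
        (gg.2 : Y.G) ^ n • (Nilmanifold.quotientProdMap X Y p₀).2) := by
  obtain ⟨⟨a, b⟩, rfl⟩ := QuotientGroup.mk_surjective p₀
  obtain ⟨g, g'⟩ := gg
  show Nilmanifold.quotientProdMap X Y
      (QuotientGroup.mk ((((g, g') : X.G × Y.G) ^ n) * (a, b))) = _
  rw [Nilmanifold.quotientProdMap_mk]
  show Nilmanifold.quotientProdMap X Y (QuotientGroup.mk ((g ^ n * a, g' ^ n * b))) = _
  rw [Nilmanifold.quotientProdMap_mk]
  rfl

/-- The same for `n ∈ ℕ`. [cite: GreenTao2008U3Inverse, §12 (the paragraph before Lemma 65)] -/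
theorem quotientProdMap_pow_smul (gg : (X.prod Y).G) (p₀ : (X.prod Y).G ⧸ (X.prod Y).Γ)
    (n : ℕ) :
    Nilmanifold.quotientProdMap X Y (gg ^ n • p₀) =
      ((gg.1 : X.G) ^ n • (Nilmanifold.quotientProdMap X Y p₀).1,
        (gg.2 : Y.G) ^ n • (Nilmanifold.quotientProdMap X Y p₀).2) := by
  have := quotientProdMap_zpow_smul X Y gg p₀ (n : ℤ)
  simpa only [zpow_natCast] using this

/-- Every point of the product is a pair: surjectivity of the coordinates, with a chosen preimage
of `(x, x')`. [folklore] -/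
theorem exists_quotientProdMap_eq (x : X.G ⧸ X.Γ) (x' : Y.G ⧸ Y.Γ) :
    ∃ p₀ : (X.prod Y).G ⧸ (X.prod Y).Γ, Nilmanifold.quotientProdMap X Y p₀ = (x, x') :=
  (Nilmanifold.bijective_quotientProdMap X Y).2 (x, x')

variable {X Y}

/-- **arXiv Lemma 65, boundedness**: `|F ⊗ F'| ≤ 1`. [cite: GreenTao2008U3Inverse, Lemma 65] -/
theorem norm_tensor_le_one {Φ₁ : X.G ⧸ X.Γ → ℂ} {Φ₂ : Y.G ⧸ Y.Γ → ℂ} (h₁ : ∀ y, ‖Φ₁ y‖ ≤ 1)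
    (h₂ : ∀ y, ‖Φ₂ y‖ ≤ 1) (p : (X.prod Y).G ⧸ (X.prod Y).Γ) :
    ‖Φ₁ (Nilmanifold.quotientProdMap X Y p).1 * Φ₂ (Nilmanifold.quotientProdMap X Y p).2‖ ≤ 1 := by
  rw [norm_mul]
  calc ‖Φ₁ _‖ * ‖Φ₂ _‖ ≤ 1 * 1 := mul_le_mul (h₁ _) (h₂ _) (norm_nonneg _) zero_le_one
    _ = 1 := one_mul 1

/-- **arXiv Lemma 65, Lipschitz constant**: if `F` is `M`-Lipschitz and `F'` is `M'`-Lipschitz (both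
`1`-bounded), then `F ⊗ F'` is `(M + M')`-Lipschitz for the max metric.
[cite: GreenTao2008U3Inverse, Lemma 65] -/
theorem norm_tensor_sub_tensor_le {Φ₁ : X.G ⧸ X.Γ → ℂ} {Φ₂ : Y.G ⧸ Y.Γ → ℂ} {M₁ M₂ : ℝ}
    (hM₁ : 0 ≤ M₁) (hM₂ : 0 ≤ M₂) (h₁ : ∀ y, ‖Φ₁ y‖ ≤ 1) (h₂ : ∀ y, ‖Φ₂ y‖ ≤ 1)
    (hL₁ : ∀ y z, ‖Φ₁ y - Φ₁ z‖ ≤ M₁ * X.dist y z) (hL₂ : ∀ y z, ‖Φ₂ y - Φ₂ z‖ ≤ M₂ * Y.dist y z)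
    (p q : (X.prod Y).G ⧸ (X.prod Y).Γ) :
    ‖Φ₁ (Nilmanifold.quotientProdMap X Y p).1 * Φ₂ (Nilmanifold.quotientProdMap X Y p).2 -
        Φ₁ (Nilmanifold.quotientProdMap X Y q).1 * Φ₂ (Nilmanifold.quotientProdMap X Y q).2‖ ≤
      (M₁ + M₂) * (X.prod Y).dist p q := by
  set a := Φ₁ (Nilmanifold.quotientProdMap X Y p).1
  set b := Φ₂ (Nilmanifold.quotientProdMap X Y p).2
  set a' := Φ₁ (Nilmanifold.quotientProdMap X Y q).1
  set b' := Φ₂ (Nilmanifold.quotientProdMap X Y q).2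
  have hd₁ : X.dist (Nilmanifold.quotientProdMap X Y p).1 (Nilmanifold.quotientProdMap X Y q).1 ≤
      (X.prod Y).dist p q := by rw [prod_dist_eq]; exact le_max_left _ _
  have hd₂ : Y.dist (Nilmanifold.quotientProdMap X Y p).2 (Nilmanifold.quotientProdMap X Y q).2 ≤
      (X.prod Y).dist p q := by rw [prod_dist_eq]; exact le_max_right _ _
  have e : a * b - a' * b' = a * (b - b') + (a - a') * b' := by ring
  rw [e]
  refine (norm_add_le _ _).trans ?_
  rw [norm_mul, norm_mul]
  have h1 : ‖a‖ * ‖b - b'‖ ≤ 1 * (M₂ * (X.prod Y).dist p q) :=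
    mul_le_mul (h₁ _) ((hL₂ _ _).trans (mul_le_mul_of_nonneg_left hd₂ hM₂)) (norm_nonneg _)
      zero_le_one
  have h2 : ‖a - a'‖ * ‖b'‖ ≤ (M₁ * (X.prod Y).dist p q) * 1 :=
    mul_le_mul ((hL₁ _ _).trans (mul_le_mul_of_nonneg_left hd₁ hM₁)) (h₂ _) (norm_nonneg _)
      (mul_nonneg hM₁ ((X.prod Y).dist_nonneg _ _))
  linarith

/-- The real part of a `1`-bounded `M`-Lipschitz complex function is `IsBoundedLipschitz M`.
[folklore] -/
theorem isBoundedLipschitz_re {Z : Nilmanifold s} {Φ : Z.G ⧸ Z.Γ → ℂ} {M : ℝ}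
    (hb : ∀ y, ‖Φ y‖ ≤ 1) (hL : ∀ y z, ‖Φ y - Φ z‖ ≤ M * Z.dist y z) :
    Z.IsBoundedLipschitz M fun y => (Φ y).re := by
  refine ⟨fun y => (Complex.abs_re_le_norm _).trans (hb y), fun y z => ?_⟩
  rw [← Complex.sub_re]
  exact (Complex.abs_re_le_norm _).trans (hL y z)

/-- The imaginary part of a `1`-bounded `M`-Lipschitz complex function is `IsBoundedLipschitz M`.
[folklore] -/
theorem isBoundedLipschitz_im {Z : Nilmanifold s} {Φ : Z.G ⧸ Z.Γ → ℂ} {M : ℝ}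
    (hb : ∀ y, ‖Φ y‖ ≤ 1) (hL : ∀ y z, ‖Φ y - Φ z‖ ≤ M * Z.dist y z) :
    Z.IsBoundedLipschitz M fun y => (Φ y).im := by
  refine ⟨fun y => (Complex.abs_im_le_norm _).trans (hb y), fun y z => ?_⟩
  rw [← Complex.sub_im]
  exact (Complex.abs_im_le_norm _).trans (hL y z)

/-- From a complex correlation to a real one: if `c ≤ ‖∑ₙ aₙ Φₙ‖` with real weights `aₙ`, then
`c/2 ≤ |∑ₙ aₙ Re Φₙ|` or `c/2 ≤ |∑ₙ aₙ Im Φₙ|`. [folklore] -/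
theorem half_le_abs_re_sum_or_im_sum {ι : Type*} (T : Finset ι) (a : ι → ℝ) (Φ : ι → ℂ) {c : ℝ}
    (hc : c ≤ ‖∑ n ∈ T, (a n : ℂ) * Φ n‖) :
    c / 2 ≤ |∑ n ∈ T, a n * (Φ n).re| ∨ c / 2 ≤ |∑ n ∈ T, a n * (Φ n).im| := by
  set z : ℂ := ∑ n ∈ T, (a n : ℂ) * Φ n with hz
  have hre : z.re = ∑ n ∈ T, a n * (Φ n).re := by
    rw [hz, Complex.re_sum]; exact Finset.sum_congr rfl fun n _ => by simp
  have him : z.im = ∑ n ∈ T, a n * (Φ n).im := by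
    rw [hz, Complex.im_sum]; exact Finset.sum_congr rfl fun n _ => by simp
  have hzn : ‖z‖ ≤ |z.re| + |z.im| := Complex.norm_le_abs_re_add_abs_im z
  rw [← hre, ← him]
  by_contra h
  push Not at h
  linarith [h.1, h.2]

end Summit.Parity.GeneralizedHardyLittlewood.GreenTaoLevelTwoGITwoCyclicInverse
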